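import Summits.Ventures.HodgeRepro2.T5WeightProjectorSum
import Summits.Ventures.HodgeRepro2.T5HaarCircle
import Summits.Ventures.HodgeRepro2.T5HaarUniqueCompact

/-!
# The `K`-type projection of `SO(2)` is the Fourier coefficient `(2π)⁻¹ ∫₀^{2π} e^{−inθ} π(k(θ)) dθ`

Tier-5 support (N4.3 = (R3), step (P2′): the `K`-types of `K_W ∩ H_j¹ = SO(2)` in the angle
coordinate `k(θ)`; route/T5-SUPPORT-p1.md §S4.13, §S4.18).  For the circle group `Circle ≅ SO(2)`
with its normalised Haar measure `haarCircle = dθ/2π` (`T5HaarCircle`) and a continuous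
finite-dimensional representation `π`:

* `haarCircle_eq_haarProb`: `haarCircle` IS the normalised Haar measure of `Circle`, hence
  right- and inversion-invariant and positive on opens (`T5HaarUniqueCompact`);
* `fourierProj`: the weight projector of `z ↦ zⁿ` for `haarCircle`, with
  `fourierProj_eq_intervalIntegral`: `Pₙ v = (2π)⁻¹ • ∫₀^{2π} e^{−inθ} • π (k(θ)) v dθ` — the
  classical Fourier coefficient, `k(θ) = Circle.exp θ`;
* `range_fourierProj`: `Pₙ` is the projector onto the `n`-th weight space;
* `sum_fourierProj_eq_self`: **the Fourier expansion into `K`-types**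
  `v = Σ_{n ∈ weights π} (2π)⁻¹ ∫₀^{2π} e^{−inθ} π(k(θ)) v dθ`.

What this file does NOT say: anything about the infinite-dimensional `π₃⁺` ([C] in N4.3): its
`K`-types `3, 5, 7, …` are read off from the printed sources, the formula above is the
finite-dimensional form of the projection used there.

Blind lane: Mathlib + own prefix; no sorry; axioms ⊆ {propext, Classical.choice, Quot.sound}.
-/

namespace Summit.Ventures.HodgeRepro2.T5CircleFourierProjector

open MeasureTheory
open Summit.Ventures.HodgeRepro2.T5SchurOrthogonality Summit.Ventures.HodgeRepro2.T5WeightSpaces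
  Summit.Ventures.HodgeRepro2.T5WeightProjector Summit.Ventures.HodgeRepro2.T5WeightProjectorSum
  Summit.Ventures.HodgeRepro2.T5CircleWeights Summit.Ventures.HodgeRepro2.T5CircleWeightSpaces
  Summit.Ventures.HodgeRepro2.T5HaarCircle Summit.Ventures.HodgeRepro2.T5HaarUniqueCompact
  Summit.Ventures.HodgeRepro2.T5SchurMathlib

variable [MeasurableSpace Circle] [BorelSpace Circle]

/-- `haarCircle` is the normalised Haar measure of the compact group `Circle`. -/
theorem haarCircle_eq_haarProb : haarCircle = haarProb Circle :=
  eq_haarProb_of_isMulLeftInvariant haarCircle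

/-- `haarCircle` is right-invariant. -/
instance : haarCircle.IsMulRightInvariant := by
  rw [haarCircle_eq_haarProb]; infer_instance

/-- `haarCircle` is inversion-invariant. -/
instance : haarCircle.IsInvInvariant := by
  rw [haarCircle_eq_haarProb]; infer_instance

/-- `haarCircle` is a Haar measure. -/
instance : haarCircle.IsHaarMeasure := by
  rw [haarCircle_eq_haarProb]; infer_instance

variable {V : Type*} [NormedAddCommGroup V] [InnerProductSpace ℂ V] [FiniteDimensional ℂ V]
variable (π : Circle →* V →L[ℂ] V)

/-- The `n`-th Fourier projector `Pₙ = ∫ conj (zⁿ) • π z ∂haarCircle`. -/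
noncomputable def fourierProj (hπ : Continuous π) (n : ℤ) : V →ₗ[ℂ] V :=
  weightProj haarCircle π (zpowChar n) hπ (continuous_coe_zpowChar n)

omit [MeasurableSpace Circle] [BorelSpace Circle] in
/-- `conj ((Circle.exp θ)ⁿ) = e^{−inθ}`. -/
lemma conj_coe_exp_zpow (n : ℤ) (θ : ℝ) :
    (starRingEnd ℂ) (((Circle.exp θ : Circle) : ℂ) ^ n) = Complex.exp (-n * (θ * Complex.I)) := by
  rw [Circle.coe_exp, ← Complex.exp_int_mul, T5TorusCharacters.conj_exp_int_mul]

omit [FiniteDimensional ℂ V] in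
/-- **The Fourier coefficient formula**: `Pₙ v = (2π)⁻¹ • ∫₀^{2π} e^{−inθ} • π (k(θ)) v dθ`. -/
theorem fourierProj_eq_intervalIntegral (hπ : Continuous π) (n : ℤ) (v : V) :
    fourierProj π hπ n v =
      (2 * Real.pi)⁻¹ • ∫ θ in (0 : ℝ)..2 * Real.pi,
        Complex.exp (-n * (θ * Complex.I)) • π (Circle.exp θ) v := by
  rw [fourierProj, weightProj_zpowChar_apply, integral_haarCircle]
  congr 1
  refine intervalIntegral.integral_congr fun θ _ => ?_
  show (starRingEnd ℂ) (((Circle.exp θ : Circle) : ℂ) ^ n) • π (Circle.exp θ) v =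
    Complex.exp (-n * (θ * Complex.I)) • π (Circle.exp θ) v
  rw [conj_coe_exp_zpow]

/-- The range of `Pₙ` is the `n`-th weight space `{v | π z v = zⁿ • v}`. -/
theorem range_fourierProj (hπ : Continuous π) (n : ℤ) :
    LinearMap.range (fourierProj π hπ n) = weightSpace π (zpowChar n) :=
  range_weightProj haarCircle π (zpowChar n) hπ (continuous_coe_zpowChar n)

/-- `Pₙ v = v` exactly when `π z v = zⁿ • v` for all `z`. -/
theorem fourierProj_apply_eq_self_iff (hπ : Continuous π) (n : ℤ) (v : V) :
    fourierProj π hπ n v = v ↔ ∀ z : Circle, π z v = ((z : ℂ) ^ n) • v := by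
  rw [fourierProj, weightProj_apply_eq_self_iff, mem_weightSpace]
  exact forall_congr' fun z => by rw [coe_zpowChar_apply]

/-- `Pₙ` commutes with the representation. -/
theorem fourierProj_comm (hπ : Continuous π) (n : ℤ) (z : Circle) (v : V) :
    fourierProj π hπ n (π z v) = π z (fourierProj π hπ n v) :=
  weightProj_comm haarCircle π (zpowChar n) hπ (continuous_coe_zpowChar n) z v

/-- **The Fourier expansion into `K`-types**: `v = Σ_{n ∈ weights π} Pₙ v`. -/
theorem sum_fourierProj_eq_self (hπ : Continuous π) (v : V) :
    ∑ n ∈ weights π, fourierProj π hπ n v = v :=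
  sum_weightProj_zpowChar_eq_self haarCircle π hπ v

/-- **The Fourier expansion, in the angle coordinate**:
`v = Σ_{n ∈ weights π} (2π)⁻¹ • ∫₀^{2π} e^{−inθ} • π (k(θ)) v dθ`. -/
theorem sum_intervalIntegral_eq_self (hπ : Continuous π) (v : V) :
    ∑ n ∈ weights π, (2 * Real.pi)⁻¹ • ∫ θ in (0 : ℝ)..2 * Real.pi,
        Complex.exp (-n * (θ * Complex.I)) • π (Circle.exp θ) v = v := by
  calc ∑ n ∈ weights π, (2 * Real.pi)⁻¹ • ∫ θ in (0 : ℝ)..2 * Real.pi,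
          Complex.exp (-n * (θ * Complex.I)) • π (Circle.exp θ) v
      = ∑ n ∈ weights π, fourierProj π hπ n v :=
        Finset.sum_congr rfl fun n _ => (fourierProj_eq_intervalIntegral π hπ n v).symm
    _ = v := sum_fourierProj_eq_self π hπ v

end Summit.Ventures.HodgeRepro2.T5CircleFourierProjector
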